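import Summits.ABC.IUTFork.LDHSyntheticCor312Failure
import HarnessLib

/-!
# The fork at [IUTchIII] Corollary 3.12, L-DH level: the deep-place refutations over an ARBITRARY base field (slot-constant primes)

Record-only file (D-0012) of the abc-iut cell (WAVE-5 prover abc-iut-w5-d157); TAKES NO SIDE on Cor. 3.12. Sequel to
`LDHPerPrimeReading` / `LDHPerPrimeReadingWitness` / `LDHSyntheticCor312Failure`, which assumed ONE place of `F₀` over the deep prime
(`[F₀:ℚ] = 1`). The hypothesis that matters is weaker — SLOT-CONSTANCY at `p`: the normalised Θ-pilot value
`θ_j(v)·ln N(v)/n_v` is the same at every place `v | p` (then the Step (v) orbit summand `θ_j(v_j) − min_a θ_j(v_a)` of abc-iut-c312-d1's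
discrepancy vanishes on EVERY tuple, `stepVDelta_sum_le_of_slotConstant`, and the tuple sum is bounded by an `ord(q)`-free constant built
from the SUMS over `v | p` of the different exponents / ramification data of the genuine completions). The synthetic input
`ThetaVolumeInput.deepAt p l N σ` (`j_E := p^{−2lN}`, `S := V(F₀)_p`) is slot-constant at EVERY prime over EVERY number field `F₀`
(`θ_j(v)·ln N(v)/n_v = j²·N·log p` at `v | p` since `ord_v(q_v) = 2lN·e_v` and `ln N(v) = f_v·log p`; `0` elsewhere), and its `p`-local
`q`-mass is `Q_p = N·log p` (fundamental identity `Σ_{v|p} e_v f_v = [F₀:ℚ]`). Hence, for EVERY number field `F₀`, every `K ⊇ F₀`,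
section `σ`, prime `p`, prime `l ≥ 5`: some depth `N` makes the per-prime reading of (1.1)/Cor. 3.12 at `p` FAIL
(`exists_deepAt_not_perPrimeReading'`) and the CLAIM-form `Cor312Of` FAIL (`exists_deepAt_not_cor312Of'`) for the synthetic input.
HONEST SCOPE as in the parents: synthetic inhabitants of abc-iut-S2's input type, not initial Θ-data; no side taken.
[cite: DupuyHilado2025, §1 (1.1), Def. 3.6.3, §3.3, §3.6, Thm. 3.10.1] [cite: Mochizuki2012, IUTchIV Thm. 1.10 Step (v) p. 27–28]
[claim: Mochizuki2012, status: disputed] for every IUT quotation.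
-/

noncomputable section

open Set NumberField IsDedekindDomain Literature.IUT.LogVolume

namespace Summit.ABC.IUTFork

variable {F₀ : Type} [Field F₀] [NumberField F₀] {K : Type} [Field K] [NumberField K] [Algebra F₀ K]

namespace DHData

/-- **Slot-constant tuples: the Step (v) tuple sum in degree `j = i+1` is `ord(q)`-FREE.** If `θ_j(v)·ln N(v)/n_v = c` for every
`v | p`, then `Σ_{v⃗} δ(p,j,v⃗)·Π Pr(v_k) ≤ ((j+1)·D + 1)·log p + (j+1)·E` with `D := Σ_{v|p} d(K_v)`, `E := Σ_{v|p} (3 + log e(K_v))`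
(crude but `N`-free: each slot's different / tame term is bounded by the sum over all places over `p`; `Σ_{v⃗} Π Pr = 1`).
[cite: Mochizuki2012, IUTchIV Thm. 1.10 Step (v) p. 27–28] -/
theorem stepVDelta_sum_le_of_slotConstant (X : PilotData F₀) (𝔽 : LocalFieldFamily F₀) {p : ℕ} [hpi : Fact p.Prime]
    (i : Fin X.lstar) (c : ℝ)
    (hconst : ∀ v : placesOver F₀ p, X.thetaPilot i v.1 * logNorm F₀ v.1 / localDegree F₀ v.1 = c) :
    (∑ e : Fin ((i : ℕ) + 1 + 1) → placesOver F₀ p, stepVDelta X 𝔽 p ((i : ℕ) + 1) e * ∏ k, weight F₀ (e k).1) ≤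
      ((((i : ℕ) : ℝ) + 2) * (∑ v : placesOver F₀ p, differentOrd p ((𝔽 p hpi.out).k v)) + 1) * Real.log p
        + (((i : ℕ) : ℝ) + 2) * ∑ v : placesOver F₀ p, (3 + Real.log (absRamificationIdx p ((𝔽 p hpi.out).k v))) := by
  have hp : p.Prime := hpi.out
  set D := ∑ v : placesOver F₀ p, differentOrd p ((𝔽 p hp).k v) with hD
  set E := ∑ v : placesOver F₀ p, (3 + Real.log (absRamificationIdx p ((𝔽 p hp).k v) : ℝ)) with hE
  have hterm : ∀ v : placesOver F₀ p, (0 : ℝ) ≤ 3 + Real.log (absRamificationIdx p ((𝔽 p hp).k v) : ℝ) := fun v => by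
    linarith [Real.log_nonneg (show (1 : ℝ) ≤ absRamificationIdx p ((𝔽 p hp).k v) by
      exact_mod_cast absRamificationIdx_pos p _)]
  have hdv : ∀ v : placesOver F₀ p, differentOrd p ((𝔽 p hp).k v) ≤ D := fun v =>
    Finset.single_le_sum (f := fun v => differentOrd p ((𝔽 p hp).k v)) (fun u _ => differentOrd_nonneg p _) (Finset.mem_univ v)
  have hev : ∀ v : placesOver F₀ p, (3 + Real.log (absRamificationIdx p ((𝔽 p hp).k v) : ℝ)) ≤ E := fun v =>
    Finset.single_le_sum (f := fun v => (3 + Real.log (absRamificationIdx p ((𝔽 p hp).k v) : ℝ))) (fun u _ => hterm u)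
      (Finset.mem_univ v)
  have hlogp : 0 ≤ Real.log p := Real.log_nonneg (by exact_mod_cast hp.one_lt.le)
  -- pointwise bound on every tuple
  have hpt : ∀ e : Fin ((i : ℕ) + 1 + 1) → placesOver F₀ p,
      stepVDelta X 𝔽 p ((i : ℕ) + 1) e ≤ ((((i : ℕ) : ℝ) + 2) * D + 1) * Real.log p + (((i : ℕ) : ℝ) + 2) * E := by
    intro e
    have hc : p.Prime ∧ 0 < (i : ℕ) + 1 ∧ (i : ℕ) + 1 - 1 < X.lstar := ⟨hp, Nat.succ_pos _, by simp [i.2]⟩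
    rw [stepVDelta, dif_pos hc]
    have h0 : X.thetaPilot ⟨(i : ℕ) + 1 - 1, hc.2.2⟩ (e (Fin.last _)).1 * logNorm F₀ (e (Fin.last _)).1 / localDegree F₀ (e (Fin.last _)).1
        - Finset.univ.inf' ⟨0, Finset.mem_univ _⟩ (fun a =>
            X.thetaPilot ⟨(i : ℕ) + 1 - 1, hc.2.2⟩ (e a).1 * logNorm F₀ (e a).1 / localDegree F₀ (e a).1) = 0 := by
      have hi : (⟨(i : ℕ) + 1 - 1, hc.2.2⟩ : Fin X.lstar) = i := Fin.ext (by simp)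
      simp only [hi, hconst, Finset.inf'_const, sub_self]
    have h1 : dSum p (fun a => (𝔽 p hp).k (e a)) ≤ (((i : ℕ) : ℝ) + 2) * D := by
      rw [dSum]
      calc ∑ a, differentOrd p ((𝔽 p hp).k (e a)) ≤ ∑ _a : Fin ((i : ℕ) + 1 + 1), D := Finset.sum_le_sum fun a _ => hdv (e a)
        _ = _ := by rw [Finset.sum_const, Finset.card_univ, Fintype.card_fin, nsmul_eq_mul]; push_cast; ring
    have h2 : (∑ a ∈ Finset.univ.filter (fun a => p - 2 < absRamificationIdx p ((𝔽 p hp).k (e a))),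
        (3 + Real.log (absRamificationIdx p ((𝔽 p hp).k (e a)) : ℝ))) ≤ (((i : ℕ) : ℝ) + 2) * E := by
      refine (Finset.sum_le_sum_of_subset_of_nonneg (Finset.filter_subset _ _) fun a _ _ => hterm (e a)).trans ?_
      calc ∑ a, (3 + Real.log (absRamificationIdx p ((𝔽 p hp).k (e a)) : ℝ)) ≤ ∑ _a : Fin ((i : ℕ) + 1 + 1), E :=
            Finset.sum_le_sum fun a _ => hev (e a)
        _ = _ := by rw [Finset.sum_const, Finset.card_univ, Fintype.card_fin, nsmul_eq_mul]; push_cast; ring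
    rw [h0, zero_add]
    nlinarith
  -- sum against the probability weights
  have hw : ∀ e : Fin ((i : ℕ) + 1 + 1) → placesOver F₀ p, 0 ≤ ∏ k, weight F₀ (e k).1 := fun e =>
    Finset.prod_nonneg fun k _ => weight_nonneg F₀ (e k).1
  have hsum1 : (∑ e : Fin ((i : ℕ) + 1 + 1) → placesOver F₀ p, ∏ k, weight F₀ (e k).1) = 1 :=
    (tupleWeights F₀ p ((i : ℕ) + 1)).sum_pr
  calc (∑ e : Fin ((i : ℕ) + 1 + 1) → placesOver F₀ p, stepVDelta X 𝔽 p ((i : ℕ) + 1) e * ∏ k, weight F₀ (e k).1)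
      ≤ ∑ e : Fin ((i : ℕ) + 1 + 1) → placesOver F₀ p,
          (((((i : ℕ) : ℝ) + 2) * D + 1) * Real.log p + (((i : ℕ) : ℝ) + 2) * E) * ∏ k, weight F₀ (e k).1 :=
        Finset.sum_le_sum fun e _ => mul_le_mul_of_nonneg_right (hpt e) (hw e)
    _ = _ := by rw [← Finset.mul_sum, hsum1, mul_one]

/-- **Slot-constant primes: `δ_p(I)` is `ord(q)`-free.** If at the prime `p` every degree `j` has `θ_j(v)·ln N(v)/n_v` constant in
`v | p`, then `δ_p(I) ≤ ((ℓ⋆+3)/2·D + 1)·log p + ((ℓ⋆+3)/2)·E` with `D`, `E` the sums over `v | p` of the different exponents and of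
`3 + log e` of the genuine completions. [cite: Mochizuki2012, IUTchIV Thm. 1.10 Step (v) p. 27–28] -/
theorem explicitDeltaAt_le_of_slotConstant (I : ThetaVolumeInput F₀ K) {p : ℕ} [hpi : Fact p.Prime]
    (hconst : ∀ i : Fin I.X.lstar, ∃ c : ℝ, ∀ v : placesOver F₀ p,
      I.X.thetaPilot i v.1 * logNorm F₀ v.1 / localDegree F₀ v.1 = c) :
    explicitDeltaAt I p ≤
      (((I.X.lstar : ℝ) + 3) / 2 * (∑ v : placesOver F₀ p, differentOrd p ((I.σ.localFieldFamily p hpi.out).k v)) + 1) * Real.log p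
        + ((I.X.lstar : ℝ) + 3) / 2 *
          ∑ v : placesOver F₀ p, (3 + Real.log (absRamificationIdx p ((I.σ.localFieldFamily p hpi.out).k v))) := by
  haveI : NeZero I.X.lstar := ⟨by have := I.X.two_le_lstar; omega⟩
  set D := ∑ v : placesOver F₀ p, differentOrd p ((I.σ.localFieldFamily p hpi.out).k v) with hD
  set E := ∑ v : placesOver F₀ p, (3 + Real.log (absRamificationIdx p ((I.σ.localFieldFamily p hpi.out).k v) : ℝ)) with hE
  have inner : ∀ i : Fin I.X.lstar,
      (∑ e : Fin ((i : ℕ) + 1 + 1) → placesOver F₀ p,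
          stepVDelta I.X I.σ.localFieldFamily p ((i : ℕ) + 1) e * ∏ k, weight F₀ (e k).1) ≤
        ((((i : ℕ) : ℝ) + 2) * D + 1) * Real.log p + (((i : ℕ) : ℝ) + 2) * E := fun i => by
    obtain ⟨c, hc⟩ := hconst i
    exact stepVDelta_sum_le_of_slotConstant I.X I.σ.localFieldFamily i c hc
  have hsum := Finset.sum_le_sum fun i (_ : i ∈ (Finset.univ : Finset (Fin I.X.lstar))) => inner i
  have hclosed : ∑ i : Fin I.X.lstar, (((((i : ℕ) : ℝ) + 2) * D + 1) * Real.log p + (((i : ℕ) : ℝ) + 2) * E) =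
      (I.X.lstar : ℝ) * (I.X.lstar + 3) / 2 * (D * Real.log p + E) + I.X.lstar * Real.log p := by
    have hC2 : ∀ x : ℝ, (x * D + 1) * Real.log p + x * E = x * (D * Real.log p + E) + Real.log p := fun x => by ring
    have hsq : ∑ i ∈ Finset.range I.X.lstar, (((i : ℕ) : ℝ) + 2) = (I.X.lstar : ℝ) * (I.X.lstar + 3) / 2 := by
      induction I.X.lstar with
      | zero => simp
      | succ n ih => rw [Finset.sum_range_succ, ih]; push_cast; ring
    simp_rw [hC2]
    rw [Finset.sum_add_distrib, ← Finset.sum_mul, Fin.sum_univ_eq_sum_range (fun i => ((i : ℝ) + 2)) I.X.lstar, hsq,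
      Finset.sum_const, Finset.card_univ, Fintype.card_fin, nsmul_eq_mul]
  have hl : (I.X.lstar : ℝ) ≠ 0 := by exact_mod_cast (NeZero.ne I.X.lstar)
  calc explicitDeltaAt I p
      ≤ (1 / (I.X.lstar : ℝ)) * ((I.X.lstar : ℝ) * (I.X.lstar + 3) / 2 * (D * Real.log p + E) + I.X.lstar * Real.log p) :=
        mul_le_mul_of_nonneg_left (hsum.trans hclosed.le) (by positivity)
    _ = _ := by
        field_simp
        ring

/-- Hence at a slot-constant prime `−|log(Θ)|_p ≤ −c_l·Q_p + ((ℓ⋆+3)/2·D + 1)·log p + ((ℓ⋆+3)/2)·E` and the per-prime reading FAILS once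
the right-hand constant is `< (c_l − 1)·Q_p`. [cite: DupuyHilado2025, §1 (1.1), Thm. 3.10.1] [claim: Mochizuki2012, status: disputed] -/
theorem not_perPrimeReading_of_slotConstant (I : ThetaVolumeInput F₀ K) {p : ℕ} [hpi : Fact p.Prime]
    (hconst : ∀ i : Fin I.X.lstar, ∃ c : ℝ, ∀ v : placesOver F₀ p,
      I.X.thetaPilot i v.1 * logNorm F₀ v.1 / localDegree F₀ v.1 = c)
    (hdeep : (((I.X.lstar : ℝ) + 3) / 2 * (∑ v : placesOver F₀ p, differentOrd p ((I.σ.localFieldFamily p hpi.out).k v)) + 1)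
          * Real.log p
        + ((I.X.lstar : ℝ) + 3) / 2 *
          ∑ v : placesOver F₀ p, (3 + Real.log (absRamificationIdx p ((I.σ.localFieldFamily p hpi.out).k v))) <
      ((((I.X.lstar : ℝ) + 1) * (2 * I.X.lstar + 1) / 6) - 1) *
        FinDivisor.ndeg F₀ (∑ v : placesOver F₀ p, FinDivisor.of v.1 (I.X.qPilot v.1))) :
    ¬ I.negAbsLogQLoc p ≤ I.negLogThetaLoc p :=
  not_perPrimeReading_of_explicitDeltaAt_lt I hpi.out ((explicitDeltaAt_le_of_slotConstant I hconst).trans_lt hdeep)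

end DHData

namespace ThetaVolumeInput

variable (p : ℕ) [hp : Fact p.Prime] (l : ℕ) (hl : l.Prime) (h5 : 5 ≤ l) (N : ℕ) (hN : 0 < N) (σ : PlaceSection F₀ K)

/-- **The synthetic input is slot-constant at EVERY prime `p'`, over any base field**: `θ_j(v)·ln N(v)/n_v = j²·N·log p` at every
`v | p` (`ord_v(q_v) = 2lN·e_v`, `ln N(v) = f_v·log p`, `n_v = e_v f_v`), and `= 0` at the places over `p' ≠ p` (not in `S`).
[cite: DupuyHilado2025, §3.3, §3.6] -/
theorem deepAt_slotConstant (p' : ℕ) [hp' : Fact p'.Prime] (i : Fin (deepAt p l hl h5 N hN σ).X.lstar) :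
    ∃ c : ℝ, ∀ v : placesOver F₀ p',
      (deepAt p l hl h5 N hN σ).X.thetaPilot i v.1 * logNorm F₀ v.1 / localDegree F₀ v.1 = c := by
  classical
  by_cases hpp : p' = p
  · subst hpp
    refine ⟨(((i : ℕ) + 1 : ℝ) ^ 2) * N * Real.log p', fun v => ?_⟩
    rw [PilotData.thetaPilot_apply']
    have hv : v.1 ∈ (deepAt p' l hl h5 N hN σ).X.S := v.2
    rw [if_pos hv]
    show (((i : ℕ) + 1 : ℝ) ^ 2) * ((PilotData.deepAt F₀ p' l hl h5 N hN).ordq v.1 : ℝ) / (2 * (l : ℕ)) * logNorm F₀ v.1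
      / localDegree F₀ v.1 = _
    rw [PilotData.deepAt_ordq p' l hl h5 N hN v.1 v.2, logNorm_eq, (mem_placesOver_iff_residueChar v.1).mp v.2, localDegree]
    have hl0 : (l : ℝ) ≠ 0 := by exact_mod_cast hl.ne_zero
    have he : (ramIdx F₀ v.1 : ℝ) ≠ 0 := by exact_mod_cast ramIdx_ne_zero F₀ v.1
    have hf : (resDeg F₀ v.1 : ℝ) ≠ 0 := by exact_mod_cast resDeg_ne_zero F₀ v.1
    push_cast
    field_simp
  · refine ⟨0, fun v => ?_⟩
    rw [PilotData.thetaPilot_apply']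
    have hv : v.1 ∉ (deepAt p l hl h5 N hN σ).X.S := by
      intro hv
      have h1 := (mem_placesOver_iff_residueChar v.1).mp v.2
      have h2 := (mem_placesOver_iff_residueChar v.1).mp (show v.1 ∈ placesOver F₀ p from hv)
      exact hpp (h1.symm.trans h2)
    rw [if_neg hv]
    simp

/-- The `p`-local `q`-mass of the synthetic input over ANY base: `Q_p = N·log p` (fundamental identity `Σ_{v|p} e_v f_v = [F₀:ℚ]`).
[cite: DupuyHilado2025, §3.3, §3.6] -/
theorem deepAt_localQMass' :
    FinDivisor.ndeg F₀ (∑ v : placesOver F₀ p, FinDivisor.of v.1 ((deepAt p l hl h5 N hN σ).X.qPilot v.1)) = (N : ℝ) * Real.log p := by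
  classical
  rw [map_sum]
  have hv : ∀ v : placesOver F₀ p, FinDivisor.ndeg F₀ (FinDivisor.of v.1 ((deepAt p l hl h5 N hN σ).X.qPilot v.1)) =
      (N : ℝ) * Real.log p * (localDegree F₀ v.1 / Module.finrank ℚ F₀) := by
    intro v
    rw [FinDivisor.ndeg_of, DHData.qPilot_apply_of_mem _ v.2]
    show (((PilotData.deepAt F₀ p l hl h5 N hN).ordq v.1 : ℝ) / (2 * (l : ℕ))) * logNorm F₀ v.1 / Module.finrank ℚ F₀ = _
    rw [PilotData.deepAt_ordq p l hl h5 N hN v.1 v.2, logNorm_eq, (mem_placesOver_iff_residueChar v.1).mp v.2, localDegree]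
    have hl0 : (l : ℝ) ≠ 0 := by exact_mod_cast hl.ne_zero
    push_cast
    field_simp
  simp_rw [hv]
  rw [← Finset.mul_sum, ← Finset.sum_div, Finset.sum_coe_sort (placesOver F₀ p) (fun v => (localDegree F₀ v : ℝ))]
  have hsum := sum_localDegree F₀ p
  have hF : (Module.finrank ℚ F₀ : ℝ) ≠ 0 := by exact_mod_cast (Module.finrank_pos).ne'
  rw [show (∑ v ∈ placesOver F₀ p, (localDegree F₀ v : ℝ)) = Module.finrank ℚ F₀ by exact_mod_cast hsum, div_self hF, mul_one]

/-- `−|log(q)| = −N·log p` for the synthetic input over ANY base. [cite: DupuyHilado2025, §3.3, Thm. 3.10.1] -/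
theorem deepAt_negAbsLogQ' : (deepAt p l hl h5 N hN σ).negAbsLogQ = -((N : ℝ) * Real.log p) := by
  classical
  rw [ThetaVolumeInput.negAbsLogQ, ← deepAt_localQMass' p l hl h5 N hN σ]
  congr 1
  congr 1
  show (∑ w ∈ placesOver F₀ p, FinDivisor.of w (((PilotData.deepAt F₀ p l hl h5 N hN).ordq w : ℝ) / (2 * (l : ℕ)))) = _
  rw [← Finset.sum_coe_sort (placesOver F₀ p)]
  refine Finset.sum_congr rfl fun v _ => ?_
  rw [DHData.qPilot_apply_of_mem _ v.2]
  rfl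

/-- The `ord(q)`-free per-prime constant of `explicitDeltaAt_le_of_slotConstant` as a total function of the prime `p'` (value `0` at
non-primes); depends on the input only through `ℓ⋆` and the genuine completions of `σ`. [cite: Mochizuki2012, IUTchIV Thm. 1.10 Step (v) p. 27–28] -/
def boundAt' (I : ThetaVolumeInput F₀ K) (p' : ℕ) : ℝ :=
  if hp' : p'.Prime then
    haveI : Fact p'.Prime := ⟨hp'⟩
    (((I.X.lstar : ℝ) + 3) / 2 * (∑ v : placesOver F₀ p', differentOrd p' ((I.σ.localFieldFamily p' hp').k v)) + 1) * Real.log p'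
      + ((I.X.lstar : ℝ) + 3) / 2 * ∑ v : placesOver F₀ p', (3 + Real.log (absRamificationIdx p' ((I.σ.localFieldFamily p' hp').k v)))
  else 0

/-- At a slot-constant prime, `−|log(Θ)|_{p'} ≤ boundAt' I p'` (drop `−c_l·Q_{p'} ≤ 0`). [cite: Mochizuki2012, IUTchIV Thm. 1.10 Step (v) p. 27–28] -/
theorem negLogThetaLoc_le_boundAt' (I : ThetaVolumeInput F₀ K) {p' : ℕ} (hp' : p'.Prime)
    (hconst : ∀ i : Fin I.X.lstar, ∃ c : ℝ, ∀ v : placesOver F₀ p',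
      I.X.thetaPilot i v.1 * logNorm F₀ v.1 / localDegree F₀ v.1 = c) :
    I.negLogThetaLoc p' ≤ boundAt' I p' := by
  haveI : Fact p'.Prime := ⟨hp'⟩
  rw [boundAt', dif_pos hp']
  exact (DHData.negLogThetaLoc_le_explicitDeltaAt I hp').trans (DHData.explicitDeltaAt_le_of_slotConstant I hconst)

/-- The bound for the synthetic input does not depend on the depth `N` (definitional). [cite: DupuyHilado2025, §3.3] -/
theorem boundAt'_deepAt_eq (N' : ℕ) (hN' : 0 < N') (p' : ℕ) :
    boundAt' (deepAt p l hl h5 N hN σ) p' = boundAt' (deepAt p l hl h5 N' hN' σ) p' := rfl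

/-- **Over ANY number field `F₀`: some depth `N` makes the per-prime (hence every per-packet) reading FAIL at `p` for the synthetic
input.** [cite: DupuyHilado2025, §1 (1.1), Thm. 3.10.1] [claim: Mochizuki2012, status: disputed] -/
theorem exists_deepAt_not_perPrimeReading' (σ : PlaceSection F₀ K) :
    ∃ (N : ℕ) (hN : 0 < N), ¬ (deepAt p l hl h5 N hN σ).negAbsLogQLoc p ≤ (deepAt p l hl h5 N hN σ).negLogThetaLoc p := by
  set I₁ := deepAt p l hl h5 1 Nat.one_pos σ with hI₁
  set L : ℕ := (l - 1) / 2 with hL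
  set B : ℝ := boundAt' I₁ p with hB
  set A : ℝ := ((((L : ℝ) + 1) * (2 * L + 1) / 6) - 1) * Real.log p with hA
  have hL2 : (2 : ℝ) ≤ L := by exact_mod_cast I₁.X.two_le_lstar
  have hlogp : 0 < Real.log p := Real.log_pos (by exact_mod_cast hp.out.one_lt)
  have hApos : 0 < A := by
    have h3 : (0 : ℝ) < (((L : ℝ) + 1) * (2 * L + 1) / 6) - 1 := by nlinarith
    positivity
  obtain ⟨N, hN⟩ := exists_nat_gt (B / A)
  refine ⟨N + 1, Nat.succ_pos N, ?_⟩
  set I := deepAt p l hl h5 (N + 1) (Nat.succ_pos N) σ with hI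
  refine DHData.not_perPrimeReading_of_slotConstant I (deepAt_slotConstant p l hl h5 (N + 1) (Nat.succ_pos N) σ p) ?_
  rw [deepAt_localQMass' p l hl h5 (N + 1) (Nat.succ_pos N) σ]
  have hBI : boundAt' I p = B := boundAt'_deepAt_eq p l hl h5 (N + 1) (Nat.succ_pos N) σ 1 Nat.one_pos p
  have hLI : (I.X.lstar : ℝ) = L := by rw [show I.X.lstar = L from rfl]
  have hgoal : boundAt' I p < ((((L : ℝ) + 1) * (2 * L + 1) / 6) - 1) * (((N + 1 : ℕ) : ℝ) * Real.log p) := by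
    rw [hBI]
    have h1 : B < A * N := ((div_lt_iff₀ hApos).mp hN).trans_eq (mul_comm _ _)
    push_cast
    nlinarith
  rw [boundAt', dif_pos hp.out, hLI] at hgoal
  rw [hLI]
  exact hgoal

/-- **Over ANY number field `F₀`: the CLAIM-form `Cor312Of` FAILS for the synthetic input of large depth** (every support prime of the
synthetic input is slot-constant; its `q`-mass sits at `p` alone). [cite: DupuyHilado2025, §1 (1.1), Thm. 3.10.1]
[cite: Mochizuki2012, IUTchIV Thm. 1.10 Steps (v)–(viii) p. 27–30] [claim: Mochizuki2012, status: disputed] -/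
theorem exists_deepAt_not_cor312Of' (σ : PlaceSection F₀ K) :
    ∃ (N : ℕ) (hN : 0 < N), ¬ (deepAt p l hl h5 N hN σ).Cor312Of := by
  set T : Finset ℕ := (2 * (NumberField.discr K).natAbs).primeFactors ∪ (placesOver F₀ p).image (residueChar F₀) with hT
  set I₁ := deepAt p l hl h5 1 Nat.one_pos σ with hI₁
  set C : ℝ := ∑ p' ∈ T, boundAt' I₁ p' + ThetaVolumeInput.archLogTheta l with hC
  set L : ℕ := (l - 1) / 2 with hL
  set A : ℝ := ((((L : ℝ) + 1) * (2 * L + 1) / 6) - 1) * Real.log p with hA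
  have hL2 : (2 : ℝ) ≤ L := by exact_mod_cast I₁.X.two_le_lstar
  have hlogp : 0 < Real.log p := Real.log_pos (by exact_mod_cast hp.out.one_lt)
  have hApos : 0 < A := by
    have h3 : (0 : ℝ) < (((L : ℝ) + 1) * (2 * L + 1) / 6) - 1 := by nlinarith
    positivity
  obtain ⟨N, hN⟩ := exists_nat_gt (C / A)
  refine ⟨N + 1, Nat.succ_pos N, fun h312 => ?_⟩
  set I := deepAt p l hl h5 (N + 1) (Nat.succ_pos N) σ with hI
  obtain ⟨w, hw⟩ := placesOver_nonempty F₀ p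
  have hpT : p ∈ I.supportPrimes := by
    have := I.residueChar_mem_supportPrimes (v := w) hw
    rwa [(mem_placesOver_iff_residueChar w).mp hw] at this
  have hQ := deepAt_localQMass' p l hl h5 (N + 1) (Nat.succ_pos N) σ
  have hLI : (I.X.lstar : ℝ) = L := by rw [show I.X.lstar = L from rfl]
  have hθp : I.negLogThetaLoc p ≤ -((((L : ℝ) + 1) * (2 * L + 1) / 6) * (((N + 1 : ℕ) : ℝ) * Real.log p)) + boundAt' I p := by
    have h1 := DHData.negLogThetaLoc_le I hp.out
    have h2 := DHData.explicitDeltaAt_le_of_slotConstant I (deepAt_slotConstant p l hl h5 (N + 1) (Nat.succ_pos N) σ p)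
    rw [hQ] at h1
    rw [boundAt', dif_pos hp.out]
    simp only [hLI] at h1 h2 ⊢
    linarith
  have hothers : ∀ p' ∈ I.supportPrimes.erase p, I.negLogThetaLoc p' ≤ boundAt' I p' := fun p' hp' => by
    haveI : Fact p'.Prime := ⟨I.prime_of_mem_supportPrimes (Finset.mem_of_mem_erase hp')⟩
    exact negLogThetaLoc_le_boundAt' I (I.prime_of_mem_supportPrimes (Finset.mem_of_mem_erase hp'))
      (deepAt_slotConstant p l hl h5 (N + 1) (Nat.succ_pos N) σ p')
  have hsum : I.negLogThetaNonarch ≤ (∑ p' ∈ I.supportPrimes, boundAt' I p')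
      - (((L : ℝ) + 1) * (2 * L + 1) / 6) * (((N + 1 : ℕ) : ℝ) * Real.log p) := by
    rw [ThetaVolumeInput.negLogThetaNonarch, ← Finset.add_sum_erase _ _ hpT, ← Finset.add_sum_erase _ (boundAt' I) hpT]
    have := Finset.sum_le_sum hothers
    linarith
  have hTI : I.supportPrimes = T := rfl
  have hbound : (∑ p' ∈ I.supportPrimes, boundAt' I p') = ∑ p' ∈ T, boundAt' I₁ p' := by
    rw [hTI]
    exact Finset.sum_congr rfl fun p' _ => boundAt'_deepAt_eq p l hl h5 (N + 1) (Nat.succ_pos N) σ 1 Nat.one_pos p'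
  have hq : I.negAbsLogQ = -(((N + 1 : ℕ) : ℝ) * Real.log p) := deepAt_negAbsLogQ' p l hl h5 (N + 1) (Nat.succ_pos N) σ
  have h312' : I.negAbsLogQ ≤ I.negLogThetaNonarch + ThetaVolumeInput.archLogTheta l := h312
  rw [hq] at h312'
  rw [hbound] at hsum
  have hkey : C < A * ((N : ℝ) + 1) := by
    have h1 : C < A * N := ((div_lt_iff₀ hApos).mp hN).trans_eq (mul_comm _ _)
    nlinarith
  have hcast : (((N + 1 : ℕ) : ℝ)) = (N : ℝ) + 1 := by push_cast; ring
  rw [hcast] at h312' hsum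
  rw [hA] at hkey
  rw [hC] at hkey
  nlinarith

end ThetaVolumeInput

end Summit.ABC.IUTFork

end
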